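import Literature.Barriers.Parity.SiegelZeroDichotomyPairHLTypeIModel
import Literature.Barriers.Parity.SiegelZeroDichotomyPairHLProp71Smooth
import Literature.Barriers.Parity.SiegelZeroDichotomyPairHLSmoothSampling
import Mathlib.MeasureTheory.Measure.Haar.NormedSpace
import Mathlib.MeasureTheory.Integral.IntegralEqImproper
import HarnessLib

/-!
# Tao–Teräväinen 2022, Proposition 7.1: the two Poisson summation steps for the main term `X`

Topic `Literature/Barriers/Parity`, sub-namespace `TaoTeravainen`; a file of the proof DAG of
`Literature.Barriers.Parity.TaoTeravainen2021_prop72_81_pair` (T. Tao, J. Teräväinen, *The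
Hardy–Littlewood–Chowla conjecture in the presence of a Siegel zero*, J. London Math. Soc. (2) 106
(2022), arXiv:2109.06291), proof of Proposition 7.1 (i), the quantity `X` in the case
`q₁ ≤ D^{1/2} q_χ² x^{-4ε}`: "By Fourier expansion of `e_{q₁}(u n₁ n₂)` and (7.4) we see that
`∑_{n₁} ψ_I(n₁n₂) e_{q₁}(u n₁ n₂) = (1_{n₂u ≡ 0 (q₁)}/n₂) ∫ ψ_I(t) dt + O_A(x^{-A})` and thus
`X = (∫ψ_I/q₁) ∑_u ∑_{n₂ : u n₂ ≡ 0 (q₁)} e_{q₁}(-au) Φ̃_t(n₂)/n₂ + O_A(x^{-A})`. From Lemma 2.2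
(performing a Fourier expansion of the `u` constraint) [the `n₂` sum is negligible] … we thus have
`X ≪_A x^{-A}`." We realise both "Fourier expansions" as Poisson summation along residue classes
(`SiegelZeroDichotomyPairHLSmoothSampling.lean`). Everything here is PROVED:

* `logBump φ v y = Φ_t(y) := 1_{y>0} φ(log y - v)` (smooth, supported in `[t/e, et]`, `t = e^v`),
  the scaling `Φ_t^{(j)}(y) = t^{-j} Φ_1^{(j)}(y/t)`, `logBumpDeriv = Φ_t'` with
  `Φ_t'(n) = Φ̃_t(n)/n` at positive integers, `∫ Φ_t' = 0`, and
  `∫ |∂^m Φ_t'| = t^{-m} I_m(φ)`;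
* `norm_sum_filter_logBumpDeriv_le` — **Poisson in `n₂`**: for `L ≥ 1`, `m ≥ 2`, `e^{v+1} ≤ M`,
  `|∑_{n₂ ≤ M, n₂ ≡ d (L)} Φ̃_t(n₂)/n₂| ≤ (π²/3)(2π)^{-m} L^{m-1} t^{-m} I_m(φ)`;
* `norm_sum_filter_plateauProfile_sub_le` — **Poisson in `n₁`**: for `n₂ ≥ 1` with `n₂ ≤ 2A`,
  `B ≤ M`, `|∑_{n₁ ≤ M, n₁ ≡ c (L)} ψ_I(n₁ n₂) - (∫ψ_I)/(L n₂)| ≤ (π²/3)(2π)^{-m} L^{m-1} n₂^{m-1} K_m Δ^{-m} (B-A)`.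
  [cite: TaoTeravainen2021, proof of Proposition 7.1 (the estimate for X)]
-/

noncomputable section

open Real MeasureTheory Filter
open scoped ContDiff Topology

namespace Literature.Barriers.Parity

namespace TaoTeravainen

open Literature.Analysis.Calculus

/-! ### `Φ_t` as a smooth function on `ℝ` -/

/-- `Φ_t(y) = 1_{y > 0} φ(log y - v)` (`t = e^v`). [cite: TaoTeravainen2021, §7
("`Φ_t(n) := φ(log n - log t)`")] -/
def logBump (φ : ℝ → ℝ) (v : ℝ) (y : ℝ) : ℝ :=
  if 0 < y then φ (Real.log y - v) else 0

/-- `Φ_t` vanishes off `(t/e, et)`. [folklore] -/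
theorem logBump_eq_zero {φ : ℝ → ℝ} (hφ : IsBump φ) {v y : ℝ}
    (hy : y ≤ Real.exp (v - 1) ∨ Real.exp (v + 1) ≤ y) : logBump φ v y = 0 := by
  unfold logBump
  split_ifs with h0
  · refine hφ.eq_zero _ ?_
    rcases hy with hy | hy
    · have : Real.log y ≤ v - 1 := by rw [Real.log_le_iff_le_exp h0]; exact hy
      rw [abs_of_nonpos (by linarith)]; linarith
    · have : v + 1 ≤ Real.log y := by rw [Real.le_log_iff_exp_le h0]; exact hy
      rw [abs_of_nonneg (by linarith)]; linarith
  · rfl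

/-- The scaling `Φ_t(y) = Φ_1(y/t)`. [folklore] -/
theorem logBump_eq_comp (φ : ℝ → ℝ) (v y : ℝ) :
    logBump φ v y = logBump φ 0 (Real.exp (-v) * y) := by
  unfold logBump
  have he : 0 < Real.exp (-v) := Real.exp_pos _
  by_cases hy : 0 < y
  · rw [if_pos hy, if_pos (mul_pos he hy), Real.log_mul he.ne' hy.ne', Real.log_exp]
    ring_nf
  · rw [if_neg hy, if_neg (by push Not at hy ⊢; exact mul_nonpos_of_nonneg_of_nonpos he.le hy)]

/-- `Φ_t` is smooth. [folklore] -/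
theorem contDiff_logBump {φ : ℝ → ℝ} (hφ : IsBump φ) (v : ℝ) : ContDiff ℝ ∞ (logBump φ v) := by
  rw [contDiff_iff_contDiffAt]
  intro y
  by_cases hy0 : 0 < y
  · -- on `(0, ∞)` the function is `φ ∘ (log - v)`
    have heq : logBump φ v =ᶠ[𝓝 y] fun z => φ (Real.log z - v) := by
      filter_upwards [Ioi_mem_nhds hy0] with z hz
      unfold logBump; rw [if_pos (show 0 < z from hz)]
    refine ContDiffAt.congr_of_eventuallyEq ?_ heq
    exact hφ.contDiff.contDiffAt.comp y ((Real.contDiffAt_log.mpr hy0.ne').sub contDiffAt_const)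
  · -- near `y ≤ 0` the function vanishes identically (on `(-∞, t/e)`)
    push Not at hy0
    have heq : logBump φ v =ᶠ[𝓝 y] fun _ => (0 : ℝ) := by
      have hlt : y < Real.exp (v - 1) := lt_of_le_of_lt hy0 (Real.exp_pos _)
      filter_upwards [Iio_mem_nhds hlt] with z hz
      exact logBump_eq_zero hφ (Or.inl (le_of_lt hz))
    exact contDiffAt_const.congr_of_eventuallyEq heq

/-- `Φ_t` has compact support, inside `[t/e, et]`. [folklore] -/
theorem tsupport_logBump_subset {φ : ℝ → ℝ} (hφ : IsBump φ) (v : ℝ) :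
    tsupport (logBump φ v) ⊆ Set.Icc (Real.exp (v - 1)) (Real.exp (v + 1)) := by
  refine closure_minimal ?_ isClosed_Icc
  intro y hy
  rw [Function.mem_support] at hy
  rw [Set.mem_Icc]
  by_contra h
  rw [not_and_or, not_le, not_le] at h
  rcases h with h | h
  · exact hy (logBump_eq_zero hφ (Or.inl h.le))
  · exact hy (logBump_eq_zero hφ (Or.inr h.le))

/-- `Φ_t` has compact support. [folklore] -/
theorem hasCompactSupport_logBump {φ : ℝ → ℝ} (hφ : IsBump φ) (v : ℝ) :
    HasCompactSupport (logBump φ v) :=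
  HasCompactSupport.of_support_subset_isCompact isCompact_Icc
    (subset_tsupport _ |>.trans (tsupport_logBump_subset hφ v))

/-- The scaling of derivatives: `Φ_t^{(j)}(y) = t^{-j} Φ_1^{(j)}(y/t)`. [folklore] -/
theorem iteratedDeriv_logBump {φ : ℝ → ℝ} (hφ : IsBump φ) (v : ℝ) (j : ℕ) :
    iteratedDeriv j (logBump φ v) =
      fun y => Real.exp (-v) ^ j * iteratedDeriv j (logBump φ 0) (Real.exp (-v) * y) := by
  have h : logBump φ v = fun y => logBump φ 0 (Real.exp (-v) * y) := funext (logBump_eq_comp φ v)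
  rw [h]
  exact iteratedDeriv_comp_const_mul ((contDiff_logBump hφ 0).of_le (by exact_mod_cast le_top)) _

/-- `Φ_t'`, i.e. `y ↦ Φ̃_t(y)/y` on `y > 0`. [cite: TaoTeravainen2021, proof of Proposition 7.1] -/
def logBumpDeriv (φ : ℝ → ℝ) (v : ℝ) : ℝ → ℝ := deriv (logBump φ v)

/-- `Φ_t'(y) = φ'(log y - v)/y` for `y > 0`. [folklore] -/
theorem logBumpDeriv_eq {φ : ℝ → ℝ} (hφ : IsBump φ) (v : ℝ) {y : ℝ} (hy : 0 < y) :
    logBumpDeriv φ v y = deriv φ (Real.log y - v) / y := by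
  unfold logBumpDeriv
  have heq : logBump φ v =ᶠ[𝓝 y] fun z => φ (Real.log z - v) := by
    filter_upwards [Ioi_mem_nhds hy] with z hz
    unfold logBump; rw [if_pos (show 0 < z from hz)]
  rw [heq.deriv_eq]
  have h1 : HasDerivAt φ (deriv φ (Real.log y - v)) (Real.log y - v) :=
    (hφ.contDiff.differentiable (by simp)).differentiableAt.hasDerivAt
  have h2 : HasDerivAt (fun z => Real.log z - v) (y⁻¹) y := by
    simpa using (Real.hasDerivAt_log hy.ne').sub_const v
  have := h1.comp y h2
  rw [show (fun z => φ (Real.log z - v)) = φ ∘ fun z => Real.log z - v from rfl, this.deriv]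
  rw [div_eq_mul_inv]

/-- `Φ_t'(n) = Φ̃_t(n)/n` at positive integers. [folklore] -/
theorem logBumpDeriv_natCast {φ : ℝ → ℝ} (hφ : IsBump φ) (v : ℝ) {n : ℕ} (hn : 1 ≤ n) :
    logBumpDeriv φ v n = deriv φ (Real.log n - v) / n :=
  logBumpDeriv_eq hφ v (by exact_mod_cast hn)

/-- `Φ_t'` is smooth. [folklore] -/
theorem contDiff_logBumpDeriv {φ : ℝ → ℝ} (hφ : IsBump φ) (v : ℝ) : ContDiff ℝ ∞ (logBumpDeriv φ v) := by
  unfold logBumpDeriv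
  have := (contDiff_logBump hφ v).iterate_deriv 1
  simpa using this

/-- `Φ_t'` vanishes off `[t/e, et]`. [folklore] -/
theorem logBumpDeriv_eq_zero {φ : ℝ → ℝ} (hφ : IsBump φ) {v y : ℝ}
    (hy : y < Real.exp (v - 1) ∨ Real.exp (v + 1) < y) : logBumpDeriv φ v y = 0 := by
  unfold logBumpDeriv
  have hy' : y ∉ tsupport (logBump φ v) := by
    intro h
    have := tsupport_logBump_subset hφ v h
    rw [Set.mem_Icc] at this
    rcases hy with hy | hy <;> linarith [this.1, this.2]
  have := iteratedDeriv_eq_zero_of_notMem_tsupport_real hy' 1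
  rwa [iteratedDeriv_one] at this

/-- `Φ_t'` has compact support. [folklore] -/
theorem hasCompactSupport_logBumpDeriv {φ : ℝ → ℝ} (hφ : IsBump φ) (v : ℝ) :
    HasCompactSupport (logBumpDeriv φ v) :=
  (hasCompactSupport_logBump hφ v).deriv

/-- `∫ Φ_t' = 0`. [cite: TaoTeravainen2021, proof of Proposition 7.1 ("`∫₀^∞ Φ̃_t(y) dy/y = ∫ φ'(u) du = 0`")] -/
theorem integral_logBumpDeriv {φ : ℝ → ℝ} (hφ : IsBump φ) (v : ℝ) : ∫ y, logBumpDeriv φ v y = 0 := by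
  have hd : ∀ y, HasDerivAt (logBump φ v) (logBumpDeriv φ v y) y := fun y =>
    ((contDiff_logBump hφ v).differentiable (by simp)).differentiableAt.hasDerivAt
  exact integral_eq_zero_of_hasDerivAt_of_integrable hd
    ((contDiff_logBumpDeriv hφ v).continuous.integrable_of_hasCompactSupport
      (hasCompactSupport_logBumpDeriv hφ v))
    ((contDiff_logBump hφ v).continuous.integrable_of_hasCompactSupport (hasCompactSupport_logBump hφ v))

/-- The constant `I_m(φ) := ∫ |Φ_1^{(m+1)}|`. [folklore] -/
def logBumpNorm (φ : ℝ → ℝ) (m : ℕ) : ℝ := ∫ y, ‖iteratedDeriv (m + 1) (logBump φ 0) y‖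

/-- `∫ |∂^m Φ_t'| = t^{-m} I_m(φ)`. [folklore] -/
theorem integral_norm_iteratedDeriv_logBumpDeriv {φ : ℝ → ℝ} (hφ : IsBump φ) (v : ℝ) (m : ℕ) :
    ∫ y, ‖iteratedDeriv m (logBumpDeriv φ v) y‖ = Real.exp (-v) ^ m * logBumpNorm φ m := by
  unfold logBumpDeriv logBumpNorm
  rw [← iteratedDeriv_succ', iteratedDeriv_logBump hφ v (m + 1)]
  have he : 0 < Real.exp (-v) := Real.exp_pos _
  simp_rw [norm_mul, norm_pow, Real.norm_eq_abs, abs_of_pos he]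
  rw [MeasureTheory.integral_const_mul, Measure.integral_comp_mul_left (fun y => |iteratedDeriv (m + 1) (logBump φ 0) y|)]
  rw [abs_of_pos (inv_pos.mpr he), smul_eq_mul, pow_succ]
  field_simp

/-! ### Complex versions -/

/-- `Φ_t'` as a complex function. [folklore] -/
def logBumpDerivC (φ : ℝ → ℝ) (v : ℝ) (y : ℝ) : ℂ := (logBumpDeriv φ v y : ℂ)

/-- Smoothness. [folklore] -/
theorem contDiff_logBumpDerivC {φ : ℝ → ℝ} (hφ : IsBump φ) (v : ℝ) : ContDiff ℝ ∞ (logBumpDerivC φ v) :=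
  Complex.ofRealCLM.contDiff.comp (contDiff_logBumpDeriv hφ v)

/-- Compact support. [folklore] -/
theorem hasCompactSupport_logBumpDerivC {φ : ℝ → ℝ} (hφ : IsBump φ) (v : ℝ) :
    HasCompactSupport (logBumpDerivC φ v) :=
  (hasCompactSupport_logBumpDeriv hφ v).comp_left Complex.ofReal_zero

/-- `∫ Φ_t' = 0` (complex). [folklore] -/
theorem integral_logBumpDerivC {φ : ℝ → ℝ} (hφ : IsBump φ) (v : ℝ) : ∫ y, logBumpDerivC φ v y = 0 := by
  unfold logBumpDerivC
  rw [integral_complex_ofReal, integral_logBumpDeriv hφ v, Complex.ofReal_zero]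

/-- `∫ |∂^m Φ_t'| = t^{-m} I_m(φ)` (complex). [folklore] -/
theorem integral_norm_iteratedDeriv_logBumpDerivC {φ : ℝ → ℝ} (hφ : IsBump φ) (v : ℝ) (m : ℕ) :
    ∫ y, ‖iteratedDeriv m (logBumpDerivC φ v) y‖ = Real.exp (-v) ^ m * logBumpNorm φ m := by
  unfold logBumpDerivC
  rw [iteratedDeriv_ofReal_comp (contDiff_logBumpDeriv hφ v) m]
  simp_rw [Complex.norm_real]
  exact integral_norm_iteratedDeriv_logBumpDeriv hφ v m

/-! ### Poisson in `n₂` -/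

/-- **Poisson summation in `n₂`**: for `L ≥ 1`, `m ≥ 2`, `v ≥ 1`, `e^{v+1} ≤ M`,
`|∑_{1 ≤ n₂ ≤ M, n₂ ≡ d (L)} Φ̃_t(n₂)/n₂| ≤ (π²/3)(2π)^{-m} L^{m-1} e^{-vm} I_m(φ)` (the main term
vanishes because `∫ Φ_t' = 0`). [cite: TaoTeravainen2021, proof of Proposition 7.1 (the estimate
for X: "we see from Lemma 2.2 that this expression is `O_A(x^{-A})`")] -/
theorem norm_sum_filter_logBumpDeriv_le {φ : ℝ → ℝ} (hφ : IsBump φ) {v : ℝ} (hv : 1 ≤ v)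
    {L : ℕ} (hL : 0 < L) (d : ℤ) {m : ℕ} (hm : 2 ≤ m) {M : ℕ} (hM : Real.exp (v + 1) ≤ M) :
    ‖∑ n ∈ (Finset.Icc 1 M).filter (fun n : ℕ => (n : ℤ) ≡ d [ZMOD L]),
        ((deriv φ (Real.log n - v) / n : ℝ) : ℂ)‖ ≤
      (π ^ 2 / 3) / (2 * π) ^ m * (L : ℝ) ^ (m - 1) * (Real.exp (-v) ^ m * logBumpNorm φ m) := by
  -- replace the summand by `Φ_t'(n)`
  have hsum : ∑ n ∈ (Finset.Icc 1 M).filter (fun n : ℕ => (n : ℤ) ≡ d [ZMOD L]),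
      ((deriv φ (Real.log n - v) / n : ℝ) : ℂ) =
      ∑ n ∈ (Finset.Icc 1 M).filter (fun n : ℕ => (n : ℤ) ≡ d [ZMOD L]), logBumpDerivC φ v n := by
    refine Finset.sum_congr rfl fun n hn => ?_
    rw [Finset.mem_filter, Finset.mem_Icc] at hn
    unfold logBumpDerivC
    rw [logBumpDeriv_natCast hφ v hn.1.1]
  rw [hsum]
  have h1 : ∀ y : ℝ, y ≤ 1 / 2 → logBumpDerivC φ v y = 0 := by
    intro y hy
    unfold logBumpDerivC
    rw [logBumpDeriv_eq_zero hφ (Or.inl ?_), Complex.ofReal_zero]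
    have : (1 : ℝ) ≤ Real.exp (v - 1) := Real.one_le_exp (by linarith)
    linarith
  have h2 : ∀ y : ℝ, (M : ℝ) + 1 / 2 ≤ y → logBumpDerivC φ v y = 0 := by
    intro y hy
    unfold logBumpDerivC
    rw [logBumpDeriv_eq_zero hφ (Or.inr (by linarith)), Complex.ofReal_zero]
  rw [sum_filter_modEq_eq_tsum hL d h1 h2]
  have hP := norm_tsum_sub_div_integral_le (contDiff_logBumpDerivC hφ v)
    (hasCompactSupport_logBumpDerivC hφ v) hm (L := (L : ℝ)) (by exact_mod_cast hL) (d : ℝ)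
  rw [integral_logBumpDerivC hφ v, mul_zero, sub_zero,
    integral_norm_iteratedDeriv_logBumpDerivC hφ v m] at hP
  exact hP

/-! ### Poisson in `n₁` -/

/-- **Poisson summation in `n₁`**: for `n₂ ≥ 1`, `L ≥ 1`, `m ≥ 2`, `Δ > 0`, `A ≤ B ≤ M`,
`n₂ ≤ 2A`: `|∑_{1 ≤ n₁ ≤ M, n₁ ≡ c (L)} ψ_I(n₁ n₂) - (∫ψ_I)/(L n₂)| ≤ (π²/3)(2π)^{-m} L^{m-1} n₂^{m-1} K_m Δ^{-m} (B - A)`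
("`∑_{n₁} ψ_I(n₁n₂) e_{q₁}(u n₁n₂) = (1_{n₂u = 0 mod q₁}/n₂) ∫_ℝ ψ_I(t) dt + O_A(x^{-A})`").
[cite: TaoTeravainen2021, proof of Proposition 7.1 (the estimate for X)] -/
theorem norm_sum_filter_plateauProfile_sub_le {A B Δ : ℝ} (hΔ : 0 < Δ) (hAB : A ≤ B) {n₂ : ℕ}
    (hn₂ : 1 ≤ n₂) (hn₂A : (n₂ : ℝ) ≤ 2 * A) {L : ℕ} (hL : 0 < L) (c : ℤ) {m : ℕ} (hm : 2 ≤ m)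
    {M : ℕ} (hBM : B ≤ M) :
    ‖(∑ n₁ ∈ (Finset.Icc 1 M).filter (fun n : ℕ => (n : ℤ) ≡ c [ZMOD L]),
        ((plateauProfile A B Δ ((n₁ * n₂ : ℕ) : ℝ) : ℝ) : ℂ)) -
        (((∫ y, plateauProfile A B Δ y) / (L * n₂) : ℝ) : ℂ)‖ ≤
      (π ^ 2 / 3) / (2 * π) ^ m * (L : ℝ) ^ (m - 1) *
        ((n₂ : ℝ) ^ (m - 1) * (plateauDerivConst m / Δ ^ m) * (B - A)) := by
  have hn₂pos : (0 : ℝ) < n₂ := by exact_mod_cast hn₂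
  have hA0 : 0 ≤ A := by linarith [hn₂pos]
  -- the summand is `g(n₁)` with `g = sampledPlateau A B Δ n₂`
  have hsum : ∑ n₁ ∈ (Finset.Icc 1 M).filter (fun n : ℕ => (n : ℤ) ≡ c [ZMOD L]),
      ((plateauProfile A B Δ ((n₁ * n₂ : ℕ) : ℝ) : ℝ) : ℂ) =
      ∑ n₁ ∈ (Finset.Icc 1 M).filter (fun n : ℕ => (n : ℤ) ≡ c [ZMOD L]),
        sampledPlateau A B Δ n₂ n₁ := by
    refine Finset.sum_congr rfl fun n₁ _ => ?_
    unfold sampledPlateau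
    push_cast
    ring_nf
  rw [hsum]
  have h1 : ∀ y : ℝ, y ≤ 1 / 2 → sampledPlateau A B Δ n₂ y = 0 := by
    intro y hy
    unfold sampledPlateau
    rw [plateauProfile_eq_zero_of_le hΔ (by nlinarith), Complex.ofReal_zero]
  have h2 : ∀ y : ℝ, (M : ℝ) + 1 / 2 ≤ y → sampledPlateau A B Δ n₂ y = 0 := by
    intro y hy
    unfold sampledPlateau
    have h1n : (1 : ℝ) ≤ n₂ := by exact_mod_cast hn₂
    rw [plateauProfile_eq_zero_of_ge hΔ (by nlinarith), Complex.ofReal_zero]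
  rw [sum_filter_modEq_eq_tsum hL c h1 h2]
  have hP := norm_tsum_sub_div_integral_le (contDiff_sampledPlateau A B Δ n₂)
    (hasCompactSupport_sampledPlateau hΔ hn₂pos.ne') hm (L := (L : ℝ)) (by exact_mod_cast hL) (c : ℝ)
  -- the integral of the sampled cutoff
  have hint : ∫ y, sampledPlateau A B Δ n₂ y = (((∫ y, plateauProfile A B Δ y) / n₂ : ℝ) : ℂ) := by
    unfold sampledPlateau
    rw [integral_complex_ofReal, Measure.integral_comp_mul_left (fun y => plateauProfile A B Δ y),
      abs_of_pos (inv_pos.mpr hn₂pos), smul_eq_mul]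
    push_cast
    ring
  rw [hint] at hP
  have hmain : (((L : ℝ)⁻¹ : ℝ) : ℂ) * (((∫ y, plateauProfile A B Δ y) / n₂ : ℝ) : ℂ) =
      (((∫ y, plateauProfile A B Δ y) / (L * n₂) : ℝ) : ℂ) := by
    push_cast
    field_simp
  rw [hmain] at hP
  refine hP.trans ?_
  gcongr
  exact integral_norm_iteratedDeriv_sampledPlateau_le hΔ hn₂pos hAB m (by omega)

end TaoTeravainen

end Literature.Barriers.Parity
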